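import Mathlib
import HarnessLib
import Literature.MathematicalPhysics.StatisticalMechanics.LinearisedMapABKMKernelSub
import Literature.MathematicalPhysics.StatisticalMechanics.LinearisedMapLargePartKernelSub
import Literature.MathematicalPhysics.StatisticalMechanics.LinearisedMapBlockPartABKMQ

/-!
# The block part `blockPart D K U` of the linearised map for TWO STEP KERNELS (same activity):
# `|blockPart D_a K U − blockPart D_b K U| ≤ C ℓ (L^d κ' c + 3ε(κ')) A^{−|U|_{k+1}}` ([ABKM19] Lemmas 10.1–10.2 ⊗ Lemma 8.4)

In the decomposition `S_k(H,K)(U) = blockPart D K U + Σ₁ + Σ₂ᴸ + Σ₃ + Σ₄` ([ABKM19] (6.59)–(6.60)) the linear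
piece on a connected `(k+1)`-polymer is the block part `blockPart = opC − largePart` (`LinearisedMap`).  Its one-kernel
Lipschitz bound in `K` is `LinearisedMapBlockPartABKMQ.tayNormLE_blockPart_sub_abkm_of_stepKernelBounds`.  For the
volume-uniform two-kernel comparison of `S_k` (child `TwoKernelSkBound` of the cruxes `HypACumulant` / `HypALocalTwoPoint`
of the route `Summits/HubbardSuperconductivity/…/Theses/ComplexGFFStiffness`, line `banach_two_kernel`) one needs the SAME
`K` at two step data `D, Db` (sharing `s, L, B₀, c₀`): from the two-kernel Lemma 10.1
(`LinearisedMapABKMKernelSub.weakNormLE_opC_sub_abkm_of_stepKernelBounds`) and the two-kernel Lemma 10.2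
(`LinearisedMapLargePartKernelSub.tayNormLE_largePart_fluct_sub`, instantiated here for the torus data):

* `tayNormLE_largePart_fluct_kernel_sub_abkm_of_stepKernelBounds` — Lemma 10.2 for the pair, torus data;
* **`tayNormLE_blockPart_kernelOnly_sub_abkm_of_stepKernelBounds`** — on a connected `(k+1)`-polymer `U`,
  `|blockPart D K U − blockPart Db K U|_{T_{k+1}^{U*}, w_{k+1}^U} ≤ C·(L^d(ℓκ')c + ℓε(κ') + ℓε(κ'))·A^{−|U|_{k+1}}`,
  with the pair property of Lemma 8.4 on connected `k`-polymers (`‖(R_a − R_b)F‖ ≤ b·ℓ·κ'^{|X|_k}`) and the large-set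
  conditions at `κ'` (`κ' ≤ A`, `2^{L^d}κ'A^{−(1−η⁻¹)} ≤ 1`).

Everything is proved; no named fact.

## References
* S. Adams, S. Buchholz, R. Kotecký, S. Müller, arXiv:1910.13564, Lemma 10.1, Lemma 10.2, Lemma 8.4, Lemma 12.6 (12.53)
  [AdamsBuchholzKoteckyMuller2019].
-/

noncomputable section

namespace Literature.MathematicalPhysics.StatisticalMechanics.GradientRG

open scoped BigOperators Classical
open Finset MeasureTheory
open Literature.MathematicalPhysics.StatisticalMechanics.TorusPolymer
  (IsPolymer blocks polys bprod blockOf thicken reblock boxCorner translate IsLatticeVec mem_polys mem_blocks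
    numBlocks isPolymer_blockOf card_blocks_eq_numBlocks blocks_blockOf closure)
open Literature.Barriers.CriticalPhenomena.LongRangePhi4.Polymer (IsConn components)
open Literature.MathematicalPhysics.QuantumFieldTheory

variable {d M : ℕ} [NeZero M]

/-- **[ABKM19] Lemma 10.2 for the DIFFERENCE of two step kernels, torus data**: `d ≥ 3`, `L` odd,
`L ≥ 2^{d+3}+16R`, `M = L^N`, `k+1 ≤ N`, the weight tower of Theorem 7.1, two step kernels with `StepKernelBounds`,
the pair property of Lemma 8.4 on connected `k`-polymers with constants `ℓ ≥ 0`, `0 ≤ κ' ≤ A` and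
`2^{L^d} κ' A^{−(1−1/η(d))} ≤ 1`; `K` with `‖K‖_k^{(A)} ≤ C`, `C^{r₀}`, local on connected polymers; `U` a non-empty
`(k+1)`-polymer: `|largePart(R_a)K(U) − largePart(R_b)K(U)|_{T_{k+1}^{U*}, w_{k+1}^U} ≤ C ℓ ε(κ') A^{−|U|_{k+1}}`.
[cite: AdamsBuchholzKoteckyMuller2019, Lemma 10.2 / Lemma 12.6 (12.53)] -/
theorem tayNormLE_largePart_fluct_kernel_sub_abkm_of_stepKernelBounds {L N Mord R n p r₀ : ℕ}
    {θbar lam μ δ₁ δ₀ A𝒫 A𝒫a A𝒫b C₂a C₂b h A : ℝ}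
    {𝒞 : ℕ → (Fin d → ZMod M) → ℝ} (hd : 3 ≤ d) (hLodd : Odd L) (hL : 2 ^ (d + 3) + 16 * R ≤ L)
    (hM : M = L ^ N) {k : ℕ} (hkN : k + 1 ≤ N)
    {𝒞a 𝒞b : (Fin d → ZMod M) → ℝ}
    (hSa : StepKernelBounds (abkmWeightData L N Mord R θbar (schedDelta δ₀ δ₁ N) 𝒞) L k A𝒫a C₂a 𝒞a)
    (hSb : StepKernelBounds (abkmWeightData L N Mord R θbar (schedDelta δ₀ δ₁ N) 𝒞) L k A𝒫b C₂b 𝒞b)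
    (hB : AbkmWeightBounds L N Mord R n θbar lam μ δ₁ δ₀ A𝒫 𝒞
      (abkmWeightData L N Mord R θbar (schedDelta δ₀ δ₁ N) 𝒞))
    (hh : 0 < h) (hA : 1 ≤ A) {κ' ℓ : ℝ} (hκ' : 0 ≤ κ') (hκ'A : κ' ≤ A) (hℓ : 0 ≤ ℓ)
    (hsmall : (2 : ℝ) ^ (L ^ d) * (κ' * A ^ (-(1 - (1 + 1 / ((2 * (2 ^ d + 1) + 6 : ℝ) ^ d))⁻¹) : ℝ)) ≤ 1)
    (hdint : ∀ X : Finset (Fin d → ZMod M), IsPolymer (L ^ k) X → IsConn X →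
      ∀ (F : ((Fin d → ZMod M) → ℝ) → ℂ) (C : ℝ), 0 ≤ C → ContDiff ℝ r₀ F →
        IsGaugeLocal ((abkmNormParams L N Mord R p r₀ h θbar A (schedDelta δ₀ δ₁ N) 𝒞).gauge k X) F →
        TayNormLE ((abkmNormParams L N Mord R p r₀ h θbar A (schedDelta δ₀ δ₁ N) 𝒞).gauge k X) r₀
          ((abkmWeightData L N Mord R θbar (schedDelta δ₀ δ₁ N) 𝒞).weight k X) F C →
          TayNormLE ((abkmNormParams L N Mord R p r₀ h θbar A (schedDelta δ₀ δ₁ N) 𝒞).gauge k X) r₀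
            ((abkmWeightData L N Mord R θbar (schedDelta δ₀ δ₁ N) 𝒞).midWeight k X)
            (fluct 𝒞a F - fluct 𝒞b F) (C * ℓ * κ' ^ numBlocks (L ^ k) X))
    {K : Finset (Fin d → ZMod M) → ((Fin d → ZMod M) → ℝ) → ℂ} {C : ℝ} (hC : 0 ≤ C)
    (hK : WeakNormLE (abkmNormParams L N Mord R p r₀ h θbar A (schedDelta δ₀ δ₁ N) 𝒞) k K C)
    (hKd : ∀ X, ContDiff ℝ r₀ (K X))
    (hKloc : ∀ X, IsPolymer (L ^ k) X → IsConn X →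
      IsGaugeLocal ((abkmNormParams L N Mord R p r₀ h θbar A (schedDelta δ₀ δ₁ N) 𝒞).gauge k X) (K X))
    {U : Finset (Fin d → ZMod M)} (hU : IsPolymer (L ^ (k + 1)) U) (hUne : U.Nonempty) :
    TayNormLE ((abkmNormParams L N Mord R p r₀ h θbar A (schedDelta δ₀ δ₁ N) 𝒞).gauge (k + 1) U) r₀
      ((abkmWeightData L N Mord R θbar (schedDelta δ₀ δ₁ N) 𝒞).weight (k + 1) U)
      (largePart (L ^ k) L (fluct 𝒞a) K U - largePart (L ^ k) L (fluct 𝒞b) K U)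
      (C * ℓ * largePartEps d L A κ' (1 + 1 / ((2 * (2 ^ d + 1) + 6 : ℝ) ^ d)) *
        (abkmNormParams L N Mord R p r₀ h θbar A (schedDelta δ₀ δ₁ N) 𝒞).aFactor (k + 1) U) := by
  set P := abkmNormParams L N Mord R p r₀ h θbar A (schedDelta δ₀ δ₁ N) 𝒞 with hP
  -- sizes
  have h8 : 8 ≤ 2 ^ (d + 3) := by
    calc 8 = 2 ^ 3 := by norm_num
      _ ≤ 2 ^ (d + 3) := Nat.pow_le_pow_right (by norm_num) (by omega)
  have h2dle : 2 ^ d ≤ 2 ^ (d + 3) := Nat.pow_le_pow_right (by norm_num) (by omega)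
  have h2dlt : 2 ^ d < 2 ^ (d + 3) := Nat.pow_lt_pow_right (by norm_num) (by omega)
  have hL4 : 4 ≤ L := by omega
  have hL2 : 2 ^ d + 1 ≤ L := by omega
  have hLR : 2 ^ d + R ≤ L := by omega
  have hL0 : (0 : ℝ) < L := by exact_mod_cast hLodd.pos
  have hA0 : 0 < A := by linarith
  have hk1 : k + 1 ≤ N + 1 := by omega
  have hMo : Odd M := by rw [hM]; exact hLodd.pow
  -- the torus at scale `k + 1`
  obtain ⟨t, ht⟩ : ∃ t, N = (k + 1) + t := ⟨N - (k + 1), by omega⟩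
  have hMt : M = P.L ^ (k + 1) * L ^ t := by
    show M = L ^ (k + 1) * L ^ t
    rw [← pow_add, ← ht]; exact hM
  have htodd : Odd (L ^ t) := hLodd.pow
  -- gauges of the two scales
  have h𝔥k : 0 < P.𝔥 k := fieldWt_pos hh hL0 d k
  have h𝔥 : 0 < P.𝔥 (k + 1) := fieldWt_pos hh hL0 d (k + 1)
  have hsucc : P.𝔥 (k + 1) = scaleRatio d L * P.𝔥 k := fieldWt_succ_nat hLodd.pos d k
  have h𝔥le : P.𝔥 (k + 1) ≤ P.𝔥 k := by
    rw [hsucc]; exact mul_le_of_le_one_left h𝔥k.le (scaleRatio_le_one hd hL4)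
  have hR : 0 < P.R k := by show (0 : ℝ) < (L : ℝ) ^ k; positivity
  have hRle : P.R k ≤ P.R (k + 1) := by
    show (L : ℝ) ^ k ≤ (L : ℝ) ^ (k + 1)
    exact pow_le_pow_right₀ (by exact_mod_cast hLodd.pos) (by omega)
  have hrad : P.rad k ≤ P.rad (k + 1) := starRad_le_succ hLR k
  have hrad' : P.rad k + (2 ^ d - 1) * P.L ^ k ≤ P.rad (k + 1) := starRad_add_le_succ hLR k
  have hη : (0 : ℝ) < 1 + 1 / ((2 * (2 ^ d + 1) + 6 : ℝ) ^ d) := by positivity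
  -- the discharged hypotheses
  have hw6 : NextWeightDominates P k := nextWeightDominates_abkm hB hLodd hLR hMt htodd p r₀ h A
  have hgain : ∀ X : Finset (Fin d → ZMod M), IsPolymer (P.L ^ k) X → IsConn X →
      2 ^ d < (blocks (P.L ^ k) X).card →
        (1 + 1 / ((2 * (2 ^ d + 1) + 6 : ℝ) ^ d)) *
          ((blocks (P.L * P.L ^ k) (closure (P.L * P.L ^ k) X)).card : ℝ) ≤ (blocks (P.L ^ k) X).card :=
    fun X hX hc hl => closureGain_pow hLodd hL2 hL4 hM hkN hX hc hl
  -- restrict `K` to connected `k`-polymers (the large part only reads those)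
  set K' : Finset (Fin d → ZMod M) → ((Fin d → ZMod M) → ℝ) → ℂ :=
    fun X => if IsPolymer (L ^ k) X ∧ IsConn X then K X else 0 with hK'def
  have hK'eq : ∀ X, IsPolymer (L ^ k) X → IsConn X → K' X = K X := fun X hX hc => by
    show (if IsPolymer (L ^ k) X ∧ IsConn X then K X else 0) = K X
    exact if_pos ⟨hX, hc⟩
  have hK' : WeakNormLE P k K' C := fun X hX hc => by rw [hK'eq X hX hc]; exact hK X hX hc
  have hK'd : ∀ X, ContDiff ℝ P.r₀ (K' X) := fun X => by
    by_cases hX : IsPolymer (L ^ k) X ∧ IsConn X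
    · simp only [hK'def, if_pos hX]; exact hKd X
    · simp only [hK'def, if_neg hX]; exact contDiff_const
  have hK'loc : ∀ X, IsPolymer (P.L ^ k) X → IsConn X → IsGaugeLocal (P.gauge k X) (K' X) :=
    fun X hX hc => by rw [hK'eq X hX hc]; exact hKloc X hX hc
  have hR'd : ∀ (𝒞q : (Fin d → ZMod M) → ℝ) {A𝒫q C₂q : ℝ},
      StepKernelBounds (abkmWeightData L N Mord R θbar (schedDelta δ₀ δ₁ N) 𝒞) L k A𝒫q C₂q 𝒞q →
      ∀ X, ContDiff ℝ P.r₀ (fluct 𝒞q (K' X)) := fun 𝒞q A𝒫q C₂q hS X => by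
    by_cases hX : IsPolymer (L ^ k) X ∧ IsConn X
    · rw [hK'eq X hX.1 hX.2]
      exact contDiff_fluct_of_weakNormLE_of_stepKernelBounds hB hS hA0 hC hK hKd hKloc hX.1 hX.2
    · have : K' X = 0 := by simp only [hK'def, if_neg hX]
      rw [this]
      have h0 : fluct 𝒞q (0 : ((Fin d → ZMod M) → ℝ) → ℂ) = fun _ => 0 := fluct_const _ 0
      rw [h0]; exact contDiff_const
  have hlp : ∀ (𝒞q : (Fin d → ZMod M) → ℝ),
      largePart (L ^ k) L (fluct 𝒞q) K U = largePart (L ^ k) L (fluct 𝒞q) K' U := by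
    intro 𝒞q
    funext φ
    unfold largePart
    refine sum_congr rfl fun X hX => ?_
    obtain ⟨hXp, hXc, -, -⟩ := mem_largePartIndex.1 hX
    rw [hK'eq X hXp hXc]
  rw [hlp 𝒞a, hlp 𝒞b]
  have hdint' : ∀ X : Finset (Fin d → ZMod M), IsPolymer (P.L ^ k) X → IsConn X →
      ∀ (F : ((Fin d → ZMod M) → ℝ) → ℂ) (C : ℝ), 0 ≤ C → ContDiff ℝ P.r₀ F →
        IsGaugeLocal (P.gauge k X) F → TayNormLE (P.gauge k X) P.r₀ (P.W.weight k X) F C →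
          TayNormLE (P.gauge k X) P.r₀ (P.W.midWeight k X) (fluct 𝒞a F - fluct 𝒞b F)
            (C * ℓ * κ' ^ numBlocks (P.L ^ k) X) := hdint
  exact tayNormLE_largePart_fluct_sub P hMt hLodd htodd h𝔥 h𝔥le hR hRle hrad hrad' hA hκ' hκ'A hη hℓ hsmall hgain
    hdint' hw6 hC hK' hK'd hK'loc (hR'd 𝒞a hSa) (hR'd 𝒞b hSb) hU hUne

/-- **Kernel-only two-kernel bound of the block part** (module docstring): with the data of
`LinearisedMapABKMKernelSub.weakNormLE_opC_sub_abkm_of_stepKernelBounds` (two step data `D, Db` of scale `k` sharing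
`s, L, B₀, c₀`; pair property with constants `ℓ`, `κ'`; large-set conditions at `κ'`; translation-invariant local
`C^{r₀}` activity `K` with `‖K‖_k^{(A)} ≤ C`), on a connected `(k+1)`-polymer `U`:
`|blockPart D K U − blockPart Db K U|_{T_{k+1}^{U*}, w_{k+1}^U} ≤ C (L^d (ℓκ') c + ℓε + ℓε) A^{−|U|_{k+1}}`.
[cite: AdamsBuchholzKoteckyMuller2019, Lemma 10.1 / Lemma 10.2 / Lemma 12.6 (12.53)] -/
theorem tayNormLE_blockPart_kernelOnly_sub_abkm_of_stepKernelBounds {L N Mord R n p r₀ : ℕ}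
    {θbar lam μ δ₁ δ₀ A𝒫 A𝒫a A𝒫b C₂a C₂b h A : ℝ}
    {𝒞 : ℕ → (Fin d → ZMod M) → ℝ} (hd : 3 ≤ d) (hLodd : Odd L) (hL : 2 ^ (d + 3) + 16 * R ≤ L)
    (hM : M = L ^ N) {k : ℕ} (hkN : k + 1 ≤ N) (hp : d / 2 + 2 ≤ p) (hpM : p + d ≤ Mord)
    (hMR : Mord ≤ R) (hr₀ : 3 ≤ r₀)
    (hB : AbkmWeightBounds L N Mord R n θbar lam μ δ₁ δ₀ A𝒫 𝒞
      (abkmWeightData L N Mord R θbar (schedDelta δ₀ δ₁ N) 𝒞))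
    (hδ₀ : 0 < δ₀) (hδ₁ : 0 < δ₁) (hh : 0 < h) (hh0 : hZeroSq d R δ₀ δ₁ ≤ h ^ 2)
    (hA : 1 ≤ A) {κ' : ℝ} (hκ' : 0 ≤ κ') (hκ'A : κ' ≤ A)
    (hsmall : (2 : ℝ) ^ (L ^ d) * (κ' * A ^ (-(1 - (1 + 1 / ((2 * (2 ^ d + 1) + 6 : ℝ) ^ d))⁻¹) : ℝ)) ≤ 1)
    (D Db : StepData d M) (hDs : D.s = L ^ k) (hDL : D.L = L)
    (hS : StepKernelBounds (abkmWeightData L N Mord R θbar (schedDelta δ₀ δ₁ N) 𝒞) L k A𝒫a C₂a D.𝒞)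
    (hSb : StepKernelBounds (abkmWeightData L N Mord R θbar (schedDelta δ₀ δ₁ N) 𝒞) L k A𝒫b C₂b Db.𝒞)
    (hDbs : Db.s = D.s) (hDbL : Db.L = D.L) (hDbB : Db.B₀ = D.B₀) (hDbc : Db.c₀ = D.c₀)
    {x₀ : Fin d → ZMod M} (hB₀ : D.B₀ = blockOf (L ^ k) x₀)
    (hc₀ : D.c₀ = boxCorner (L ^ k) (starRad R L d k) x₀)
    {ℓ : ℝ} (hℓ : 0 ≤ ℓ)
    (hdint : ∀ X : Finset (Fin d → ZMod M), IsPolymer (L ^ k) X → IsConn X →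
      ∀ (F : ((Fin d → ZMod M) → ℝ) → ℂ) (C : ℝ), 0 ≤ C → ContDiff ℝ r₀ F →
        IsGaugeLocal ((abkmNormParams L N Mord R p r₀ h θbar A (schedDelta δ₀ δ₁ N) 𝒞).gauge k X) F →
        TayNormLE ((abkmNormParams L N Mord R p r₀ h θbar A (schedDelta δ₀ δ₁ N) 𝒞).gauge k X) r₀
          ((abkmWeightData L N Mord R θbar (schedDelta δ₀ δ₁ N) 𝒞).weight k X) F C →
          TayNormLE ((abkmNormParams L N Mord R p r₀ h θbar A (schedDelta δ₀ δ₁ N) 𝒞).gauge k X) r₀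
            ((abkmWeightData L N Mord R θbar (schedDelta δ₀ δ₁ N) 𝒞).midWeight k X)
            (fluct D.𝒞 F - fluct Db.𝒞 F) (C * ℓ * κ' ^ numBlocks (L ^ k) X))
    {K : Finset (Fin d → ZMod M) → ((Fin d → ZMod M) → ℝ) → ℂ} {C : ℝ} (hC : 0 ≤ C)
    (hK : WeakNormLE (abkmNormParams L N Mord R p r₀ h θbar A (schedDelta δ₀ δ₁ N) 𝒞) k K C)
    (hKt : TransInv (L ^ k) K) (hKd : ∀ X, ContDiff ℝ r₀ (K X))
    (hKloc : ∀ X, IsPolymer (L ^ k) X → IsConn X →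
      IsGaugeLocal ((abkmNormParams L N Mord R p r₀ h θbar A (schedDelta δ₀ δ₁ N) 𝒞).gauge k X) (K X))
    {U : Finset (Fin d → ZMod M)} (hU : IsPolymer (L ^ (k + 1)) U) (hUc : IsConn U) :
    TayNormLE ((abkmNormParams L N Mord R p r₀ h θbar A (schedDelta δ₀ δ₁ N) 𝒞).gauge (k + 1) U) r₀
      ((abkmWeightData L N Mord R θbar (schedDelta δ₀ δ₁ N) 𝒞).weight (k + 1) U)
      (fun φ => blockPart D K U φ - blockPart Db K U φ)
      (C * ((L : ℝ) ^ d * ((ℓ * κ') * abkmContrConst d L R) +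
          ℓ * largePartEps d L A κ' (1 + 1 / ((2 * (2 ^ d + 1) + 6 : ℝ) ^ d)) +
          ℓ * largePartEps d L A κ' (1 + 1 / ((2 * (2 ^ d + 1) + 6 : ℝ) ^ d))) *
        (abkmNormParams L N Mord R p r₀ h θbar A (schedDelta δ₀ δ₁ N) 𝒞).aFactor (k + 1) U) := by
  set P := abkmNormParams L N Mord R p r₀ h θbar A (schedDelta δ₀ δ₁ N) 𝒞 with hP
  set W := abkmWeightData L N Mord R θbar (schedDelta δ₀ δ₁ N) 𝒞 with hW
  have hA0 : 0 < A := by linarith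
  have hk1 : k + 1 ≤ N + 1 := by omega
  have hη : (0 : ℝ) < 1 + 1 / ((2 * (2 ^ d + 1) + 6 : ℝ) ^ d) := by positivity
  have hMo : Odd M := by rw [hM]; exact hLodd.pow
  have h8 : 8 ≤ 2 ^ (d + 3) := by
    calc 8 = 2 ^ 3 := by norm_num
      _ ≤ 2 ^ (d + 3) := Nat.pow_le_pow_right (by norm_num) (by omega)
  have h2dle : 2 ^ d ≤ 2 ^ (d + 3) := Nat.pow_le_pow_right (by norm_num) (by omega)
  have h2dlt : 2 ^ d < 2 ^ (d + 3) := Nat.pow_lt_pow_right (by norm_num) (by omega)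
  have hL4 : 4 ≤ L := by omega
  have hL2 : 2 ^ d + 1 ≤ L := by omega
  have hgain : ∀ X : Finset (Fin d → ZMod M), IsPolymer (L ^ k) X → IsConn X →
      2 ^ d < (blocks (L ^ k) X).card →
        (1 + 1 / ((2 * (2 ^ d + 1) + 6 : ℝ) ^ d)) *
          ((blocks (L * L ^ k) (closure (L * L ^ k) X)).card : ℝ) ≤ (blocks (L ^ k) X).card :=
    fun X hX hc hl => closureGain_pow hLodd hL2 hL4 hM hkN hX hc hl
  have hRd : ∀ (Dq : StepData d M) {A𝒫q C₂q : ℝ},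
      StepKernelBounds (abkmWeightData L N Mord R θbar (schedDelta δ₀ δ₁ N) 𝒞) L k A𝒫q C₂q Dq.𝒞 →
      ∀ X, IsPolymer (L ^ k) X → IsConn X → ContDiff ℝ r₀ (fluct Dq.𝒞 (K X)) := fun Dq A𝒫q C₂q hSq X hX hc =>
    contDiff_fluct_of_weakNormLE_of_stepKernelBounds hB hSq hA0 hC hK hKd hKloc hX hc
  -- the two pieces: `opC` (Lemma 10.1 for the pair) and the large part (Lemma 10.2 for the pair)
  -- `opC` only reads `K` on connected polymers; restrict `K` to get `C^{r₀}` fluctuation integrals everywhere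
  obtain ⟨t', ht'⟩ : ∃ t', N = k + t' := ⟨N - k, by omega⟩
  have hMt' : M = L ^ k * L ^ t' := by rw [← pow_add, ← ht']; exact hM
  have hsodd : Odd (L ^ k) := hLodd.pow
  have ht'odd : Odd (L ^ t') := hLodd.pow
  set K' : Finset (Fin d → ZMod M) → ((Fin d → ZMod M) → ℝ) → ℂ :=
    fun X => if IsPolymer (L ^ k) X ∧ IsConn X then K X else 0 with hK'def
  have hK'eq : ∀ X, IsPolymer (L ^ k) X → IsConn X → K' X = K X := fun X hX hc => by
    show (if IsPolymer (L ^ k) X ∧ IsConn X then K X else 0) = K X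
    exact if_pos ⟨hX, hc⟩
  have hK'ne : ∀ X, ¬ (IsPolymer (L ^ k) X ∧ IsConn X) → K' X = 0 := fun X hX => by
    show (if IsPolymer (L ^ k) X ∧ IsConn X then K X else 0) = 0
    exact if_neg hX
  have hK' : WeakNormLE P k K' C := fun X hX hc => by rw [hK'eq X hX hc]; exact hK X hX hc
  have hK'd : ∀ X, ContDiff ℝ r₀ (K' X) := fun X => by
    by_cases hX : IsPolymer (L ^ k) X ∧ IsConn X
    · rw [hK'eq X hX.1 hX.2]; exact hKd X
    · rw [hK'ne X hX]; exact contDiff_const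
  have hK'loc : ∀ X, IsPolymer (L ^ k) X → IsConn X → IsGaugeLocal (P.gauge k X) (K' X) :=
    fun X hX hc => by rw [hK'eq X hX hc]; exact hKloc X hX hc
  have hR'd : ∀ (Dq : StepData d M) {A𝒫q C₂q : ℝ},
      StepKernelBounds (abkmWeightData L N Mord R θbar (schedDelta δ₀ δ₁ N) 𝒞) L k A𝒫q C₂q Dq.𝒞 →
      ∀ X, ContDiff ℝ r₀ (fluct Dq.𝒞 (K' X)) := fun Dq A𝒫q C₂q hSq X => by
    by_cases hX : IsPolymer (L ^ k) X ∧ IsConn X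
    · rw [hK'eq X hX.1 hX.2]; exact hRd Dq hSq X hX.1 hX.2
    · rw [hK'ne X hX]
      have h0 : fluct Dq.𝒞 (0 : ((Fin d → ZMod M) → ℝ) → ℂ) = fun _ => 0 := fluct_const _ 0
      rw [h0]; exact contDiff_const
  have hK't : TransInv (L ^ k) K' := by
    intro a ha X φ
    by_cases hX : IsPolymer (L ^ k) X ∧ IsConn X
    · have hX' : IsPolymer (L ^ k) (translate a X) ∧ IsConn (translate a X) :=
        ⟨TorusPolymer.isPolymer_translate hMt' hsodd ht'odd ha hX.1, TorusPolymer.isConn_translate hX.2 a⟩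
      rw [hK'eq _ hX'.1 hX'.2, hK'eq X hX.1 hX.2]
      exact hKt a ha X φ
    · have hX' : ¬ (IsPolymer (L ^ k) (translate a X) ∧ IsConn (translate a X)) := by
        intro h'
        apply hX
        have e : translate (-a) (translate a X) = X := by
          rw [TorusPolymer.translate_translate, add_neg_cancel, TorusPolymer.translate_zero]
        exact ⟨e ▸ TorusPolymer.isPolymer_translate hMt' hsodd ht'odd ha.neg h'.1, e ▸ TorusPolymer.isConn_translate h'.2 (-a)⟩
      rw [hK'ne _ hX', hK'ne X hX]
      rfl
  -- `blockPart D K = blockPart D K'`, `largePart … K = largePart … K'`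
  have hbP : ∀ (Dq : StepData d M), Dq.s = L ^ k → Dq.B₀ = blockOf (L ^ k) x₀ →
      blockPart Dq K U = blockPart Dq K' U := by
    intro Dq hDqs hDqB
    have hB₀c : IsPolymer (L ^ k) Dq.B₀ ∧ IsConn Dq.B₀ := by
      rw [hDqB]; exact ⟨isPolymer_blockOf _ x₀, TorusPolymer.isConn_blockOf hMo hsodd x₀⟩
    have hopB : opB Dq K' = opB Dq K := by
      unfold opB; rw [hK'eq Dq.B₀ hB₀c.1 hB₀c.2]
    funext φ
    unfold blockPart
    refine sum_congr rfl fun B hB' => ?_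
    have hBb := blockPartIndex_subset_blocks Dq U hB'
    rw [hDqs] at hBb
    obtain ⟨y, -, rfl⟩ := mem_blocks.1 hBb
    unfold blockTerm
    rw [hopB, hK'eq _ (isPolymer_blockOf _ y) (TorusPolymer.isConn_blockOf hMo hsodd y)]
  have hlP : ∀ (𝒞q : (Fin d → ZMod M) → ℝ),
      largePart (L ^ k) L (fluct 𝒞q) K U = largePart (L ^ k) L (fluct 𝒞q) K' U := by
    intro 𝒞q
    funext φ
    unfold largePart
    refine sum_congr rfl fun X hX => ?_
    obtain ⟨hXp, hXc, -, -⟩ := mem_largePartIndex.1 hX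
    rw [hK'eq X hXp hXc]
  have hDbs' : Db.s = L ^ k := hDbs.trans hDs
  have hDbL' : Db.L = L := hDbL.trans hDL
  have hB₀b : Db.B₀ = blockOf (L ^ k) x₀ := hDbB.trans hB₀
  -- (1) Lemma 10.1 for the pair, evaluated on the connected `(k+1)`-polymer `U`
  have h1w := weakNormLE_opC_sub_abkm_of_stepKernelBounds (n := n) (lam := lam) (μ := μ) hd hLodd hL hM hkN hp hpM hMR
    hr₀ hB hδ₀ hδ₁ hh hh0 hκ' hA hκ'A hη hsmall hgain D Db hDs hDL hS hSb hDbs hDbL hDbB hDbc hB₀ hc₀ hℓ hdint hC hK'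
    hK't hK'd hK'loc (hR'd D hS) (hR'd Db hSb)
  have h1 := h1w U hU hUc
  -- (2) Lemma 10.2 for the pair
  have h2 := tayNormLE_largePart_fluct_kernel_sub_abkm_of_stepKernelBounds (p := p) (r₀ := r₀) hd hLodd hL hM hkN hS hSb
    hB hh hA hκ' hκ'A hℓ hsmall hdint hC hK' hK'd hK'loc hU hUc.1
  -- smoothness
  have hbd : ∀ (Dq : StepData d M) {A𝒫q C₂q : ℝ}, Dq.s = L ^ k →
      StepKernelBounds (abkmWeightData L N Mord R θbar (schedDelta δ₀ δ₁ N) 𝒞) L k A𝒫q C₂q Dq.𝒞 →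
      ContDiff ℝ r₀ (blockPart Dq K' U) := fun Dq A𝒫q C₂q hDqs hSq =>
    contDiff_blockPart_abkm_of_stepKernelBounds hB hLodd hM hA0 Dq hDqs hSq hC hK' hK'd hK'loc U
  have hld : ∀ (𝒞q : (Fin d → ZMod M) → ℝ) {A𝒫q C₂q : ℝ},
      StepKernelBounds (abkmWeightData L N Mord R θbar (schedDelta δ₀ δ₁ N) 𝒞) L k A𝒫q C₂q 𝒞q →
      ContDiff ℝ r₀ (largePart (L ^ k) L (fluct 𝒞q) K' U) := fun 𝒞q A𝒫q C₂q hSq =>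
    contDiff_largePart_abkm_of_stepKernelBounds (p := p) (r₀ := r₀) hB hSq hA0 hC hK' hK'd hK'loc U
  have hopCd : ContDiff ℝ r₀ ((opC D K' - opC Db K') U) := by
    have : (opC D K' - opC Db K') U = fun φ => (blockPart D K' U φ + largePart D.s D.L (fluct D.𝒞) K' U φ) -
        (blockPart Db K' U φ + largePart Db.s Db.L (fluct Db.𝒞) K' U φ) := by funext φ; rfl
    rw [this, hDs, hDL, hDbs', hDbL']
    exact ((hbd D hDs hS).add (hld D.𝒞 hS)).sub ((hbd Db hDbs' hSb).add (hld Db.𝒞 hSb))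
  have hlsd : ContDiff ℝ r₀ (largePart (L ^ k) L (fluct D.𝒞) K' U - largePart (L ^ k) L (fluct Db.𝒞) K' U) :=
    (hld D.𝒞 hS).sub (hld Db.𝒞 hSb)
  -- `blockPart_a − blockPart_b = (opC_a − opC_b) − (largePart_a − largePart_b)`
  have heq : (fun φ => blockPart D K U φ - blockPart Db K U φ) =
      (opC D K' - opC Db K') U +
        (-1 : ℝ) • (largePart (L ^ k) L (fluct D.𝒞) K' U - largePart (L ^ k) L (fluct Db.𝒞) K' U) := by
    rw [hbP D hDs hB₀, hbP Db hDbs' hB₀b]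
    funext φ
    show blockPart D K' U φ - blockPart Db K' U φ =
      ((blockPart D K' U φ + largePart D.s D.L (fluct D.𝒞) K' U φ) -
        (blockPart Db K' U φ + largePart Db.s Db.L (fluct Db.𝒞) K' U φ)) +
      (-1 : ℝ) • (largePart (L ^ k) L (fluct D.𝒞) K' U φ - largePart (L ^ k) L (fluct Db.𝒞) K' U φ)
    rw [hDs, hDL, hDbs', hDbL', neg_one_smul]
    ring
  rw [heq]
  refine ((h1.add (h2.smul hlsd (-1)) hopCd (hlsd.const_smul (-1 : ℝ))).mono (le_of_eq ?_)
    fun φ => (W.weight_pos (k + 1) U φ).le)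
  rw [abs_neg, abs_one, one_mul]
  ring

end Literature.MathematicalPhysics.StatisticalMechanics.GradientRG

end
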